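import Summits.AtomisticToContinuum.Crystallization.Theses.SurfaceTensionNoFoam
import Summits.AtomisticToContinuum.Crystallization.Theses.PalmUnimodularRigidity
import Summits.AtomisticToContinuum.Crystallization.Theorems.PalmUnimodularRigidityCruxesToPalmRigidity
import Summits.AtomisticToContinuum.Crystallization.Theorems.PalmUnimodularRigidityShellsToBarlowChart
import Summits.AtomisticToContinuum.Crystallization.Theorems.PalmUnimodularRigidityPalmToHinge
import Literature.Probability.Process.PointStationaryLaw

/-!
# Birth skeleton — crux `SurfaceTensionNoFoam.DeloneMinimisersChargePeriodic`

Item `stmt-AtomisticToContinuum-13449` (crux, rank 3, route `SurfaceTensionNoFoam`, sub-problem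
`Crystallization`; BULK half of the thesis `ExposedSitesCost ∧ DeloneMinimisersChargePeriodic`).

The crux (rooted = point-stationary form): for all `δ, r₀ > 0` and every probability law `P` on
counting measures `μ` of `ℝ³` that is (a) a.s. rooted and `δ`-hard-core, (b) point-stationary
(Mecke / mass-transport identity), (c) a.s. `r₀`-relatively dense (Delone) and (d) minimising,
`E_P[½ Σ_{y ∈ μ} V_LJ(‖y‖)] ≤ e* = ⨅_Q e(Q)`, there is ONE periodic configuration `Q` such that
for all `R, ε > 0`, with positive `P`-probability the atoms of `μ` in the ball of radius `R` are
two-way `ε`-matched with an isometric copy `A(Q.points − q)`, `q ∈ Q.points`.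

This skeleton realises the route header's *foreseen split 2* ("DeloneMinimisersChargePeriodic ⇐
Delone close-packed shells → layered laws select a period → crux, mirroring cruxes 9225–9227 of
`PalmUnimodularRigidity` so that children can be SHARED with that route"), using what has LANDED
on the hub since: the robust layer theorem `ShellsToBarlowChart` (item 9227, proved:
`Cruxes.ShellsToBarlowChart.DevelopTheModelGrowthDescent.ShellsToBarlowChart_of`), the
unimodular transfer "root a.s. ⇒ every point a.s." (`Theorems.PalmUnimodularRigidity.
ae_forall_map_sub_of_ae`, from the proved glue 9228) and the support-point / Lipschitz-matching
helpers of the proved hinge glue 9231 (`exists_mem_forall_nhds_measure_ne_zero`,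
`dist_barlowPos_barlowPos_le`).  TWO named stubs and one PROVED lemma:

* `stub_deloneMinimiserShells` (HARDEST, load-bearing; where hypothesis (c) enters) — the
  Delone-weakened form of the hub crux `PalmUnimodularRigidity.MinimiserShells` (item 9225): a
  minimising point-stationary hard-core law that is a.s. `r₀`-relatively dense has, a.s., a
  close-packed ROOT shell (twelve points within `5a/4`, `(a/100)`-matched after rotation to the
  `a`-scaled FCC or HCP kissing pattern, `a ∈ [9/10, 1]`).  Strictly weaker than 9225 (drop (c):
  `stub_deloneMinimiserShells_of_minimiserShells` below, no `sorry`), so it closes when 9225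
  closes; the Delone hypothesis is exactly what spares the proof the pricing of vacuum-adjacent
  roots (walls, half-crystals, foam, the sparse COMB of `Cruxes/MinimiserShells/Disproof.lean` §2b)
  that 9225 must do by energy and transport alone.  It keeps every hypothesis that Disproof shows
  load-bearing for 9225 (energy `E_P[h] ≤ e*`, §2a; Mecke identity, §2b) and inherits its §4
  moral: slack versions are false (mix a near-optimal periodic law with the uniformly rooted bcc
  crystal, which is Delone with all shells bad), so a proof must use EXACT minimality.
* `stub_layeredLawsSelectHcp` — VERBATIM the hub crux `PalmUnimodularRigidity.LayeredLawsSelectHcp`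
  (item 9226, shared by signature; `Iff.rfl` check below): minimising point-stationary laws
  carried by every-point-close-packed, globally Barlow-charted configurations are a.s. exact
  rotated relaxed HCP crystals `count|A(hcpStacking a h)` with `e(hcp a h) = e*`.  (No Delone
  variant is filed: a Barlow-charted every-point-close-packed set is automatically relatively
  dense, so (c) buys nothing here and the verbatim shared item — with its registered lines
  `Cruxes/LayeredLawsSelectHcp/Lines/*` — is the right child.)
* `hcpLawsChargeHcp` (PROVED here, no `sorry`) — the measure-level shadow of the proved hinge
  glue `PalmToHinge` (9231): a probability law a.s. carried by rotated relaxed HCP crystals with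
  parameters in the compact box `[1/2, 2]²` charges ONE periodic configuration at every scale with
  positive probability (support point `(a₀, h₀)` of the parameter law by compactness; crystals
  with `η`-close parameters are `2ηR`-close index by index inside the ball of radius `R`).

Assembly `DeloneMinimisersChargePeriodic_of` (real proof, no `sorry`): Delone shells at the root
a.s. (stub 1) ⇒ (transfer) close-packed shells at every point a.s. ⇒ (`ShellsToBarlowChart_of`,
`0 ∈ S`) a global Barlow chart a.s. ⇒ (`stub_layeredLawsSelectHcp`) a.s. rotated relaxed HCP ⇒
(`hcpLawsChargeHcp`) one periodic `Q` charged at every scale.  Net statement of the line: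
13449 ⟸ DeloneMinimiserShells ∧ 9226, kernel-checked.  Also recorded, both SORRY-FREE:
`DeloneMinimisersChargePeriodic_of_palmRigidity : PalmRigidity → crux` (the route header's remark
"PalmRigidity (9224) implies this crux outright", now a theorem) and
`DeloneMinimisersChargePeriodic_of_hubCruxes : MinimiserShells → LayeredLawsSelectHcp → crux`.

Sorries: exactly the two stubs (`lean check`: rc 0, errors 0, sorries 2; `_of` and
`_of_palmRigidity` axioms `[propext, Classical.choice, Quot.sound]`).  BC3 probes (folder `bc/`):
for each stub, `stub → crux` and `stub → Crystallization` by each of `exact?`, `simpa`,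
`simpa [defs]`, `unfold; simpa`, `aesop` (400000 heartbeats apiece) all FAIL (20/20), and the
converse `crux → stub` fails too: neither stub is the crux or the sub-problem reworded.
Disproof used: none on file for THIS crux (no `Cruxes/DeloneMinimisersChargePeriodic/Disproof.lean`
at registration); the hub cruxes' `Disproof.lean` files are honoured as said above.  Negatives
index: no stub asserts a first-shell classification of FINITE ground states or of bare 12-point
shells (the refuted 4146 / 15929-type statements); both quantify over minimising point-stationary
laws, exactly as the open items 9225 / 9226 do.
-/

namespace Summit.AtomisticToContinuum.Crystallization.Cruxes.DeloneMinimisersChargePeriodic.Birth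

open scoped BigOperators Topology Manifold Classical MeasureTheory ProbabilityTheory Matrix InnerProductSpace ComplexConjugate ContinuousMap
open Filter Set Function TopologicalSpace MeasureTheory

/-- **Stub 1 (hardest) — Delone minimising laws have close-packed root shells.**  The
Delone-weakened form of the hub crux `PalmUnimodularRigidity.MinimiserShells` (item 9225): for
all `δ, r₀ > 0` and every probability law `P` on rooted `δ`-hard-core configurations of `ℝ³` that
is point-stationary, a.s. `r₀`-relatively dense and minimising (`E_P[h] ≤ e*`), `P`-a.s. the root
has a close-packed first shell: a scale `a ∈ [9/10, 1]` such that the points `y ≠ 0` with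
`‖y‖ ≤ 5a/4` form a finite set `(a/100)`-close (after a rotation) to the `a`-scaled FCC or HCP
kissing pattern.  Open (the frustration crux; Blanc–Lewin 2015 §2.3, Flatley–Theil 2015); XL. -/
theorem stub_deloneMinimiserShells : ∀ δ r₀ : ℝ, 0 < δ → 0 < r₀ → ∀ P : MeasureTheory.Measure (MeasureTheory.Measure (EuclideanSpace ℝ (Fin 3))), MeasureTheory.IsProbabilityMeasure P → (∀ᵐ μ ∂P, (∃ S : Set (EuclideanSpace ℝ (Fin 3)), (0 : EuclideanSpace ℝ (Fin 3)) ∈ S ∧ (∀ x ∈ S, ∀ y ∈ S, x ≠ y → δ ≤ dist x y) ∧ μ = (MeasureTheory.Measure.count : MeasureTheory.Measure (EuclideanSpace ℝ (Fin 3))).restrict S)) → (∀ g : MeasureTheory.Measure (EuclideanSpace ℝ (Fin 3)) → EuclideanSpace ℝ (Fin 3) → ENNReal, Measurable (Function.uncurry g) → ∫⁻ μ, ∫⁻ y, g μ y ∂μ ∂P = ∫⁻ μ, ∫⁻ y, g (MeasureTheory.Measure.map (fun z => z - y) μ) (-y) ∂μ ∂P) → (∀ᵐ μ ∂P, ∀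 c : EuclideanSpace ℝ (Fin 3), ∃ y : EuclideanSpace ℝ (Fin 3), μ {y} ≠ 0 ∧ dist y c ≤ r₀) → (∫ μ, (∫ y, Literature.MathematicalPhysics.StatisticalMechanics.lennardJones ‖y‖ ∂μ) / 2 ∂P) ≤ (⨅ Q : Literature.MathematicalPhysics.StatisticalMechanics.PeriodicConfiguration 3, Q.energyPerParticle Literature.MathematicalPhysics.StatisticalMechanics.lennardJones) → ∀ᵐ μ ∂P, (∃ a : ℝ, 9 / 10 ≤ a ∧ a ≤ 1 ∧ ∃ T : Finset (EuclideanSpace ℝ (Fin 3)), (↑T : Set (EuclideanSpace ℝ (Fin 3))) = {y : EuclideanSpace ℝ (Fin 3) | μ {y} ≠ 0 ∧ y ≠ 0 ∧ ‖y‖ ≤ 5 / 4 * a} ∧ (Literature.Geometry.DiscreteGeometry.ShellCloseTo (a / 100) T (Finset.image (fun v : EuclideanSpace ℝ (Fin 3) => a • v) Literature.Geometry.DiscreteGeometry.fccKissingPattern) ∨ Literature.Geometry.DiscreteGeometry.ShellCloseTo (a / 100) T (Finset.image (fun v : EuclideanSpace ℝ (Fin 3) => a • v) Literature.Geometry.DiscreteGeometry.hcpKissingPattern)))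 := by
  sorry

/-- **Stub 2 — layered minimising laws are exact relaxed HCP** (VERBATIM the shared hub crux
`PalmUnimodularRigidity.LayeredLawsSelectHcp`, item stmt-AtomisticToContinuum-9226): a minimising
point-stationary `δ`-hard-core law a.s. carried by configurations `S` all of whose points have
`(1/100)`-close-packed shells and which are globally bond-isomorphic to an ideal Barlow stacking
is a.s. an exact rotated relaxed HCP crystal `count|A(hcpStacking a h)`, `(a, h) ∈ [1/2, 2]²`,
with `e(hcp a h) = e*`.  Open; XL (Hägg domination with certified couplings ⇒ fault density 0;
harmonic + anharmonic rigidity of relaxed hcp in the 1 % tube; `e(hcp a h) ≥ e* ≥ E_P[h]`). -/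
theorem stub_layeredLawsSelectHcp : ∀ δ : ℝ, 0 < δ → ∀ P : MeasureTheory.Measure (MeasureTheory.Measure (EuclideanSpace ℝ (Fin 3))), MeasureTheory.IsProbabilityMeasure P → (∀ᵐ μ ∂P, (∃ S : Set (EuclideanSpace ℝ (Fin 3)), (0 : EuclideanSpace ℝ (Fin 3)) ∈ S ∧ (∀ x ∈ S, ∀ y ∈ S, x ≠ y → δ ≤ dist x y) ∧ μ = (MeasureTheory.Measure.count : MeasureTheory.Measure (EuclideanSpace ℝ (Fin 3))).restrict S)) → (∀ g : MeasureTheory.Measure (EuclideanSpace ℝ (Fin 3)) → EuclideanSpace ℝ (Fin 3) → ENNReal, Measurable (Function.uncurry g) → ∫⁻ μ, ∫⁻ y, g μ y ∂μ ∂P = ∫⁻ μ, ∫⁻ y, g (MeasureTheory.Measure.map (fun z => z - y) μ) (-y) ∂μ ∂P) → (∫ μ, (∫ y, Literature.MathematicalPhysics.StatisticalMechanics.lennardJones ‖y‖ ∂μ) / 2 ∂P) ≤ (⨅ Q : Literature.MathematicalPhysics.StatisticalMechanics.PeriodicConfiguration 3, Q.energyPerParticle Literature.MathematicalPhysics.StatisticalMechanics.lennardJones)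 → (∀ᵐ μ ∂P, ∃ S : Set (EuclideanSpace ℝ (Fin 3)), μ = (MeasureTheory.Measure.count : MeasureTheory.Measure (EuclideanSpace ℝ (Fin 3))).restrict S ∧ (∀ x ∈ S, (∃ a : ℝ, 9 / 10 ≤ a ∧ a ≤ 1 ∧ ∃ T : Finset (EuclideanSpace ℝ (Fin 3)), (↑T : Set (EuclideanSpace ℝ (Fin 3))) = (fun y : EuclideanSpace ℝ (Fin 3) => y - x) '' {y : EuclideanSpace ℝ (Fin 3) | y ∈ S ∧ y ≠ x ∧ dist y x ≤ 5 / 4 * a} ∧ (Literature.Geometry.DiscreteGeometry.ShellCloseTo (a / 100) T (Finset.image (fun v : EuclideanSpace ℝ (Fin 3) => a • v) Literature.Geometry.DiscreteGeometry.fccKissingPattern) ∨ Literature.Geometry.DiscreteGeometry.ShellCloseTo (a / 100) T (Finset.image (fun v : EuclideanSpace ℝ (Fin 3) => a • v) Literature.Geometry.DiscreteGeometry.hcpKissingPattern)))) ∧ (∃ s : ℤ → ℤ, Literature.MathematicalPhysics.StatisticalMechanics.IsHaggSeq s ∧ ∃ Φ : EuclideanSpace ℝ (Fin 3) → EuclideanSpace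 ℝ (Fin 3), Set.BijOn Φ (Literature.MathematicalPhysics.StatisticalMechanics.barlowStacking 1 (Real.sqrt (2 / 3)) s) S ∧ ∀ p ∈ Literature.MathematicalPhysics.StatisticalMechanics.barlowStacking 1 (Real.sqrt (2 / 3)) s, ∀ q ∈ Literature.MathematicalPhysics.StatisticalMechanics.barlowStacking 1 (Real.sqrt (2 / 3)) s, (dist p q = 1 ↔ (0 < dist (Φ p) (Φ q) ∧ dist (Φ p) (Φ q) ≤ 28 / 25)))) → ∀ᵐ μ ∂P, (∃ a h : ℝ, ∃ ha : a ≠ 0, ∃ hh : h ≠ 0, 1 / 2 ≤ a ∧ a ≤ 2 ∧ 1 / 2 ≤ h ∧ h ≤ 2 ∧ ∃ A : EuclideanSpace ℝ (Fin 3) ≃ₗᵢ[ℝ] EuclideanSpace ℝ (Fin 3), (Literature.MathematicalPhysics.StatisticalMechanics.hcpPeriodicConfiguration ha hh).energyPerParticle Literature.MathematicalPhysics.StatisticalMechanics.lennardJones = (⨅ Q : Literature.MathematicalPhysics.StatisticalMechanics.PeriodicConfiguration 3, Q.energyPerParticle Literature.MathematicalPhysics.StatisticalMechanics.lennardJones)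 ∧ μ = (MeasureTheory.Measure.count : MeasureTheory.Measure (EuclideanSpace ℝ (Fin 3))).restrict (A '' Literature.MathematicalPhysics.StatisticalMechanics.hcpStacking a h)) := by
  sorry

/-! ### The charging lemma (proved): laws carried by rotated relaxed HCP crystals charge one `Q` -/

/-- **Laws carried by rotated relaxed HCP crystals charge one periodic configuration** (the
measure-level shadow of the proved hinge glue `PalmToHinge`, item 9231; proved here, no `sorry`):
if `P`-a.e. configuration is `count|A(hcpStacking a h)` for some linear isometry `A` and parameters
`(a, h)` in the compact box `[1/2, 2]²`, then ONE periodic configuration `Q` — the relaxed HCP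
crystal with parameters at a support point `(a₀, h₀)` of the parameter law
(`exists_mem_forall_nhds_measure_ne_zero`, finite subcover) — is charged at every scale: for all
`R, ε > 0`, with positive `P`-probability the atoms in the ball of radius `R` are two-way
`ε`-matched with `A(Q.points − 0)` (crystals with `η`-close parameters are `2ηR`-close index by
index inside the ball, `dist_barlowPos_barlowPos_le`, `η = ε / (2R)`). -/
theorem hcpLawsChargeHcp (P : MeasureTheory.Measure (MeasureTheory.Measure (EuclideanSpace ℝ (Fin 3))))
    (hP : MeasureTheory.IsProbabilityMeasure P)
    (hae : ∀ᵐ μ ∂P, ∃ a h : ℝ, 1 / 2 ≤ a ∧ a ≤ 2 ∧ 1 / 2 ≤ h ∧ h ≤ 2 ∧ ∃ A : EuclideanSpace ℝ (Fin 3) ≃ₗᵢ[ℝ] EuclideanSpace ℝ (Fin 3), μ = (MeasureTheory.Measure.count : MeasureTheory.Measure (EuclideanSpace ℝ (Fin 3))).restrict (A '' Literature.MathematicalPhysics.StatisticalMechanics.hcpStacking a h)) :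
    ∃ Q : Literature.MathematicalPhysics.StatisticalMechanics.PeriodicConfiguration 3, ∀ R ε : ℝ, 0 < R → 0 < ε → 0 < P {μ | ∃ A : EuclideanSpace ℝ (Fin 3) →ₗᵢ[ℝ] EuclideanSpace ℝ (Fin 3), ∃ q ∈ Q.points, (∀ s ∈ Q.points, dist s q ≤ R → ∃ y : EuclideanSpace ℝ (Fin 3), μ {y} ≠ 0 ∧ dist y (A (s - q)) ≤ ε) ∧ (∀ y : EuclideanSpace ℝ (Fin 3), μ {y} ≠ 0 → ‖y‖ ≤ R → ∃ s ∈ Q.points, dist y (A (s - q)) ≤ ε)} := by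
  haveI := hP
  -- the parameter box and the parametrised event
  set K : Set (ℝ × ℝ) := Icc (1 / 2 : ℝ) 2 ×ˢ Icc (1 / 2 : ℝ) 2 with hKdef
  have hK : IsCompact K := isCompact_Icc.prod isCompact_Icc
  set p : Measure (EuclideanSpace ℝ (Fin 3)) → ℝ × ℝ → Prop := fun μ z =>
    (1 / 2 ≤ z.1 ∧ z.1 ≤ 2 ∧ 1 / 2 ≤ z.2 ∧ z.2 ≤ 2) ∧
      ∃ A : EuclideanSpace ℝ (Fin 3) ≃ₗᵢ[ℝ] EuclideanSpace ℝ (Fin 3),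
        μ = (Measure.count : Measure (EuclideanSpace ℝ (Fin 3))).restrict
          (A '' Literature.MathematicalPhysics.StatisticalMechanics.hcpStacking z.1 z.2)
    with hpdef
  have hae' : ∀ᵐ μ ∂P, ∃ z ∈ K, p μ z := by
    filter_upwards [hae] with μ hμ
    obtain ⟨a, h, h1, h2, h3, h4, A, hμ⟩ := hμ
    exact ⟨(a, h), ⟨⟨h1, h2⟩, ⟨h3, h4⟩⟩, ⟨h1, h2, h3, h4⟩, A, hμ⟩
  haveI : NeZero P := ⟨IsProbabilityMeasure.ne_zero P⟩
  obtain ⟨⟨a₀, h₀⟩, hzK, hsupp⟩ :=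
    Summit.AtomisticToContinuum.Crystallization.Theorems.PalmUnimodularRigidity.exists_mem_forall_nhds_measure_ne_zero
      P hK p hae'
  obtain ⟨⟨ha₀, ha₀'⟩, ⟨hh₀, hh₀'⟩⟩ := hzK
  have ha₀0 : a₀ ≠ 0 := by intro h0; rw [h0] at ha₀; norm_num at ha₀
  have hh₀0 : h₀ ≠ 0 := by intro h0; rw [h0] at hh₀; norm_num at hh₀
  refine ⟨Literature.MathematicalPhysics.StatisticalMechanics.hcpPeriodicConfiguration ha₀0 hh₀0, ?_⟩
  intro R ε hR hε
  -- tolerance `η = ε / (2R)`: index-wise drift `2ηR ≤ ε` inside the ball of radius `R`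
  set η : ℝ := ε / (2 * R) with hηdef
  have hηpos : 0 < η := by positivity
  have hηR : 2 * η * R ≤ ε := by
    have : 2 * η * R = ε := by rw [hηdef]; field_simp
    exact this.le
  -- the charged set of crystals with `η`-close parameters
  set T : Set (Measure (EuclideanSpace ℝ (Fin 3))) :=
    {μ | ∃ z ∈ Metric.ball ((a₀, h₀) : ℝ × ℝ) η, p μ z} with hTdef
  have hT : P T ≠ 0 := hsupp _ (Metric.ball_mem_nhds _ hηpos)
  refine (pos_iff_ne_zero.2 hT).trans_le (measure_mono ?_)
  -- every such crystal is `(R, ε)`-matched both ways with the reference crystal `hcp a₀ h₀`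
  rintro μ ⟨⟨a, h⟩, hz, ⟨ha, ha', hh, hh'⟩, A, rfl⟩
  rw [Metric.mem_ball, Prod.dist_eq, max_lt_iff, Real.dist_eq, Real.dist_eq] at hz
  rw [Set.mem_setOf_eq]
  refine ⟨A.toLinearIsometry, 0, ?_, ?_, ?_⟩
  · rw [Literature.MathematicalPhysics.StatisticalMechanics.hcpPeriodicConfiguration_points]
    exact Summit.AtomisticToContinuum.Crystallization.Theorems.PalmUnimodularRigidity.zero_mem_hcpStacking a₀ h₀
  · rw [Literature.MathematicalPhysics.StatisticalMechanics.hcpPeriodicConfiguration_points]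
    rintro s ⟨k, m, n, rfl⟩ hsR
    rw [dist_zero_right] at hsR
    refine ⟨A (Literature.MathematicalPhysics.StatisticalMechanics.barlowPos a h
        Literature.MathematicalPhysics.StatisticalMechanics.alternatingHagg k m n),
      (Literature.Probability.Process.count_restrict_singleton_ne_zero_iff _ _).2 ⟨_, ⟨k, m, n, rfl⟩, rfl⟩,
      ?_⟩
    rw [sub_zero, LinearIsometryEquiv.coe_toLinearIsometry, LinearIsometryEquiv.dist_map]
    calc dist (Literature.MathematicalPhysics.StatisticalMechanics.barlowPos a h
            Literature.MathematicalPhysics.StatisticalMechanics.alternatingHagg k m n)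
          (Literature.MathematicalPhysics.StatisticalMechanics.barlowPos a₀ h₀
            Literature.MathematicalPhysics.StatisticalMechanics.alternatingHagg k m n)
        ≤ 2 * η * ‖Literature.MathematicalPhysics.StatisticalMechanics.barlowPos a₀ h₀
            Literature.MathematicalPhysics.StatisticalMechanics.alternatingHagg k m n‖ :=
          Summit.AtomisticToContinuum.Crystallization.Theorems.PalmUnimodularRigidity.dist_barlowPos_barlowPos_le
            _ k m n ha₀ hh₀ hηpos.le hz.1.le hz.2.le
      _ ≤ 2 * η * R := mul_le_mul_of_nonneg_left hsR (by positivity)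
      _ ≤ ε := hηR
  · rw [Literature.MathematicalPhysics.StatisticalMechanics.hcpPeriodicConfiguration_points]
    intro y hy hyR
    obtain ⟨s', ⟨k, m, n, rfl⟩, rfl⟩ :=
      (Literature.Probability.Process.count_restrict_singleton_ne_zero_iff _ _).1 hy
    refine ⟨Literature.MathematicalPhysics.StatisticalMechanics.barlowPos a₀ h₀
        Literature.MathematicalPhysics.StatisticalMechanics.alternatingHagg k m n, ⟨k, m, n, rfl⟩, ?_⟩
    rw [sub_zero, LinearIsometryEquiv.coe_toLinearIsometry, LinearIsometryEquiv.dist_map, dist_comm]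
    rw [LinearIsometryEquiv.norm_map] at hyR
    have haa' : |a₀ - a| ≤ η := by rw [abs_sub_comm]; exact hz.1.le
    have hhh' : |h₀ - h| ≤ η := by rw [abs_sub_comm]; exact hz.2.le
    calc dist (Literature.MathematicalPhysics.StatisticalMechanics.barlowPos a₀ h₀
            Literature.MathematicalPhysics.StatisticalMechanics.alternatingHagg k m n)
          (Literature.MathematicalPhysics.StatisticalMechanics.barlowPos a h
            Literature.MathematicalPhysics.StatisticalMechanics.alternatingHagg k m n)
        ≤ 2 * η * ‖Literature.MathematicalPhysics.StatisticalMechanics.barlowPos a h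
            Literature.MathematicalPhysics.StatisticalMechanics.alternatingHagg k m n‖ :=
          Summit.AtomisticToContinuum.Crystallization.Theorems.PalmUnimodularRigidity.dist_barlowPos_barlowPos_le
            _ k m n ha hh hηpos.le haa' hhh'
      _ ≤ 2 * η * R := mul_le_mul_of_nonneg_left hyR (by positivity)
      _ ≤ ε := hηR

/-- **Assembly** (real proof, no `sorry`): stub 1 → stub 2 → the crux
`SurfaceTensionNoFoam.DeloneMinimisersChargePeriodic` BY NAME.  Delone close-packed ROOT shells
a.s. (stub 1) ⇒ close-packed shells at EVERY point a.s. (unimodular transfer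
`ae_forall_map_sub_of_ae`; hard-core configurations are locally finite; re-rooted shells
identified by `map_sub_count_restrict` + `shell_image_sub_eq`) ⇒ a global Barlow chart a.s.
(landed `ShellsToBarlowChart_of`, applicable since `0 ∈ S`) ⇒ a.s. rotated relaxed HCP (stub 2)
⇒ one periodic `Q` charged at every scale with positive probability (the proved charging lemma
`hcpLawsChargeHcp`). -/
theorem DeloneMinimisersChargePeriodic_of : (∀ δ r₀ : ℝ, 0 < δ → 0 < r₀ → ∀ P : MeasureTheory.Measure (MeasureTheory.Measure (EuclideanSpace ℝ (Fin 3))), MeasureTheory.IsProbabilityMeasure P → (∀ᵐ μ ∂P, (∃ S : Set (EuclideanSpace ℝ (Fin 3)), (0 : EuclideanSpace ℝ (Fin 3)) ∈ S ∧ (∀ x ∈ S, ∀ y ∈ S, x ≠ y → δ ≤ dist x y) ∧ μ = (MeasureTheory.Measure.count : MeasureTheory.Measure (EuclideanSpace ℝ (Fin 3))).restrict S)) → (∀ g : MeasureTheory.Measure (EuclideanSpace ℝ (Fin 3)) → EuclideanSpace ℝ (Fin 3) → ENNReal, Measurable (Function.uncurry g) → ∫⁻ μ, ∫⁻ y, g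 μ y ∂μ ∂P = ∫⁻ μ, ∫⁻ y, g (MeasureTheory.Measure.map (fun z => z - y) μ) (-y) ∂μ ∂P) → (∀ᵐ μ ∂P, ∀ c : EuclideanSpace ℝ (Fin 3), ∃ y : EuclideanSpace ℝ (Fin 3), μ {y} ≠ 0 ∧ dist y c ≤ r₀) → (∫ μ, (∫ y, Literature.MathematicalPhysics.StatisticalMechanics.lennardJones ‖y‖ ∂μ) / 2 ∂P) ≤ (⨅ Q : Literature.MathematicalPhysics.StatisticalMechanics.PeriodicConfiguration 3, Q.energyPerParticle Literature.MathematicalPhysics.StatisticalMechanics.lennardJones) → ∀ᵐ μ ∂P, (∃ a : ℝ, 9 / 10 ≤ a ∧ a ≤ 1 ∧ ∃ T : Finset (EuclideanSpace ℝ (Fin 3)), (↑T : Set (EuclideanSpace ℝ (Fin 3))) = {y : EuclideanSpace ℝ (Fin 3) | μ {y} ≠ 0 ∧ y ≠ 0 ∧ ‖y‖ ≤ 5 / 4 * a} ∧ (Literature.Geometry.DiscreteGeometry.ShellCloseTo (a / 100) T (Finset.image (fun v : EuclideanSpace ℝ (Fin 3) => a • v) Literature.Geometry.DiscreteGeometry.fccKissingPattern)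 ∨ Literature.Geometry.DiscreteGeometry.ShellCloseTo (a / 100) T (Finset.image (fun v : EuclideanSpace ℝ (Fin 3) => a • v) Literature.Geometry.DiscreteGeometry.hcpKissingPattern)))) → (∀ δ : ℝ, 0 < δ → ∀ P : MeasureTheory.Measure (MeasureTheory.Measure (EuclideanSpace ℝ (Fin 3))), MeasureTheory.IsProbabilityMeasure P → (∀ᵐ μ ∂P, (∃ S : Set (EuclideanSpace ℝ (Fin 3)), (0 : EuclideanSpace ℝ (Fin 3)) ∈ S ∧ (∀ x ∈ S, ∀ y ∈ S, x ≠ y → δ ≤ dist x y) ∧ μ = (MeasureTheory.Measure.count : MeasureTheory.Measure (EuclideanSpace ℝ (Fin 3))).restrict S)) → (∀ g : MeasureTheory.Measure (EuclideanSpace ℝ (Fin 3)) → EuclideanSpace ℝ (Fin 3) → ENNReal, Measurable (Function.uncurry g) → ∫⁻ μ, ∫⁻ y, g μ y ∂μ ∂P = ∫⁻ μ, ∫⁻ y, g (MeasureTheory.Measure.map (fun z => z - y) μ) (-y) ∂μ ∂P) → (∫ μ, (∫ y, Literature.MathematicalPhysics.StatisticalMechanics.lennardJones ‖y‖ ∂μ)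 / 2 ∂P) ≤ (⨅ Q : Literature.MathematicalPhysics.StatisticalMechanics.PeriodicConfiguration 3, Q.energyPerParticle Literature.MathematicalPhysics.StatisticalMechanics.lennardJones) → (∀ᵐ μ ∂P, ∃ S : Set (EuclideanSpace ℝ (Fin 3)), μ = (MeasureTheory.Measure.count : MeasureTheory.Measure (EuclideanSpace ℝ (Fin 3))).restrict S ∧ (∀ x ∈ S, (∃ a : ℝ, 9 / 10 ≤ a ∧ a ≤ 1 ∧ ∃ T : Finset (EuclideanSpace ℝ (Fin 3)), (↑T : Set (EuclideanSpace ℝ (Fin 3))) = (fun y : EuclideanSpace ℝ (Fin 3) => y - x) '' {y : EuclideanSpace ℝ (Fin 3) | y ∈ S ∧ y ≠ x ∧ dist y x ≤ 5 / 4 * a} ∧ (Literature.Geometry.DiscreteGeometry.ShellCloseTo (a / 100) T (Finset.image (fun v : EuclideanSpace ℝ (Fin 3) => a • v) Literature.Geometry.DiscreteGeometry.fccKissingPattern) ∨ Literature.Geometry.DiscreteGeometry.ShellCloseTo (a / 100) T (Finset.image (fun v : EuclideanSpace ℝ (Fin 3) => a • v) Literature.Geometry.DiscreteGeometry.hcpKissingPattern))))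 ∧ (∃ s : ℤ → ℤ, Literature.MathematicalPhysics.StatisticalMechanics.IsHaggSeq s ∧ ∃ Φ : EuclideanSpace ℝ (Fin 3) → EuclideanSpace ℝ (Fin 3), Set.BijOn Φ (Literature.MathematicalPhysics.StatisticalMechanics.barlowStacking 1 (Real.sqrt (2 / 3)) s) S ∧ ∀ p ∈ Literature.MathematicalPhysics.StatisticalMechanics.barlowStacking 1 (Real.sqrt (2 / 3)) s, ∀ q ∈ Literature.MathematicalPhysics.StatisticalMechanics.barlowStacking 1 (Real.sqrt (2 / 3)) s, (dist p q = 1 ↔ (0 < dist (Φ p) (Φ q) ∧ dist (Φ p) (Φ q) ≤ 28 / 25)))) → ∀ᵐ μ ∂P, (∃ a h : ℝ, ∃ ha : a ≠ 0, ∃ hh : h ≠ 0, 1 / 2 ≤ a ∧ a ≤ 2 ∧ 1 / 2 ≤ h ∧ h ≤ 2 ∧ ∃ A : EuclideanSpace ℝ (Fin 3) ≃ₗᵢ[ℝ] EuclideanSpace ℝ (Fin 3), (Literature.MathematicalPhysics.StatisticalMechanics.hcpPeriodicConfiguration ha hh).energyPerParticle Literature.MathematicalPhysics.StatisticalMechanics.lennardJones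 = (⨅ Q : Literature.MathematicalPhysics.StatisticalMechanics.PeriodicConfiguration 3, Q.energyPerParticle Literature.MathematicalPhysics.StatisticalMechanics.lennardJones) ∧ μ = (MeasureTheory.Measure.count : MeasureTheory.Measure (EuclideanSpace ℝ (Fin 3))).restrict (A '' Literature.MathematicalPhysics.StatisticalMechanics.hcpStacking a h))) → Summit.AtomisticToContinuum.Crystallization.Theses.SurfaceTensionNoFoam.DeloneMinimisersChargePeriodic := by
  intro hShells hSelect δ r₀ hδ hr₀ P hP hcore hstat hdense hmin
  -- stub 1: close-packed ROOT shell, a.s.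
  have hroot := hShells δ r₀ hδ hr₀ P hP hcore hstat hdense hmin
  -- hard-core configurations are locally finite
  have hlf : ∀ᵐ μ ∂P, ∀ n : ℕ,
      μ ((fun z : EuclideanSpace ℝ (Fin 3) => ⌊‖z‖⌋₊) ⁻¹' {n}) < ⊤ := by
    filter_upwards [hcore] with μ hμ n
    obtain ⟨S, -, hsep, rfl⟩ := hμ
    exact Summit.AtomisticToContinuum.Crystallization.Theorems.PalmUnimodularRigidity.count_restrict_floorNorm_preimage_lt_top
      hδ hsep n
  -- transfer: close-packed shell at EVERY point, a.s.
  have hall :=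
    Summit.AtomisticToContinuum.Crystallization.Theorems.PalmUnimodularRigidity.ae_forall_map_sub_of_ae
      hstat hlf hroot
  -- stub 2 on the every-point-good, Barlow-charted law: a.s. rotated relaxed HCP
  have hPalm := hSelect δ hδ P hP hcore hstat hmin (by
    filter_upwards [hcore, hall] with μ hc ha
    obtain ⟨S, h0, hsep, rfl⟩ := hc
    refine ⟨S, rfl, ?good,
      Summit.AtomisticToContinuum.Crystallization.Cruxes.ShellsToBarlowChart.DevelopTheModelGrowthDescent.ShellsToBarlowChart_of
        S ⟨0, h0⟩ ?good⟩
    intro x hx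
    obtain ⟨a, ha1, ha2, T, hT, hsh⟩ :=
      ha x ((Literature.Probability.Process.count_restrict_singleton_ne_zero_iff S x).2 hx)
    refine ⟨a, ha1, ha2, T, ?_, hsh⟩
    rw [hT, Literature.Probability.Process.map_sub_count_restrict,
      Summit.AtomisticToContinuum.Crystallization.Theorems.PalmUnimodularRigidity.shell_image_sub_eq])
  -- the charging lemma: the a.s.-HCP law charges one periodic configuration at every scale
  refine hcpLawsChargeHcp P hP ?_
  filter_upwards [hPalm] with μ hμ
  obtain ⟨a, h, ha, hh, h1, h2, h3, h4, A, -, hμA⟩ := hμ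
  exact ⟨a, h, h1, h2, h3, h4, A, hμA⟩

/-- The assembly instantiated with the two stubs: the crux, modulo exactly the two `sorry`s. -/
theorem DeloneMinimisersChargePeriodic_skeleton :
    Summit.AtomisticToContinuum.Crystallization.Theses.SurfaceTensionNoFoam.DeloneMinimisersChargePeriodic :=
  DeloneMinimisersChargePeriodic_of stub_deloneMinimiserShells stub_layeredLawsSelectHcp

/-! ### Sharing checks (no `sorry`) -/

/-- Stub 1 is implied by the hub crux `PalmUnimodularRigidity.MinimiserShells` (item 9225):
drop the Delone hypothesis. -/
theorem stub_deloneMinimiserShells_of_minimiserShells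
    (hMS : Summit.AtomisticToContinuum.Crystallization.Theses.PalmUnimodularRigidity.MinimiserShells) :
    ∀ δ r₀ : ℝ, 0 < δ → 0 < r₀ → ∀ P : MeasureTheory.Measure (MeasureTheory.Measure (EuclideanSpace ℝ (Fin 3))), MeasureTheory.IsProbabilityMeasure P → (∀ᵐ μ ∂P, (∃ S : Set (EuclideanSpace ℝ (Fin 3)), (0 : EuclideanSpace ℝ (Fin 3)) ∈ S ∧ (∀ x ∈ S, ∀ y ∈ S, x ≠ y → δ ≤ dist x y) ∧ μ = (MeasureTheory.Measure.count : MeasureTheory.Measure (EuclideanSpace ℝ (Fin 3))).restrict S)) → (∀ g : MeasureTheory.Measure (EuclideanSpace ℝ (Fin 3)) → EuclideanSpace ℝ (Fin 3) → ENNReal, Measurable (Function.uncurry g) → ∫⁻ μ, ∫⁻ y, g μ y ∂μ ∂P = ∫⁻ μ, ∫⁻ y, g (MeasureTheory.Measure.map (fun z => z - y) μ) (-y) ∂μ ∂P) → (∀ᵐ μ ∂P, ∀ c : EuclideanSpace ℝ (Fin 3), ∃ y : EuclideanSpace ℝ (Fin 3), μ {y} ≠ 0 ∧ dist y c ≤ r₀)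 → (∫ μ, (∫ y, Literature.MathematicalPhysics.StatisticalMechanics.lennardJones ‖y‖ ∂μ) / 2 ∂P) ≤ (⨅ Q : Literature.MathematicalPhysics.StatisticalMechanics.PeriodicConfiguration 3, Q.energyPerParticle Literature.MathematicalPhysics.StatisticalMechanics.lennardJones) → ∀ᵐ μ ∂P, (∃ a : ℝ, 9 / 10 ≤ a ∧ a ≤ 1 ∧ ∃ T : Finset (EuclideanSpace ℝ (Fin 3)), (↑T : Set (EuclideanSpace ℝ (Fin 3))) = {y : EuclideanSpace ℝ (Fin 3) | μ {y} ≠ 0 ∧ y ≠ 0 ∧ ‖y‖ ≤ 5 / 4 * a} ∧ (Literature.Geometry.DiscreteGeometry.ShellCloseTo (a / 100) T (Finset.image (fun v : EuclideanSpace ℝ (Fin 3) => a • v) Literature.Geometry.DiscreteGeometry.fccKissingPattern) ∨ Literature.Geometry.DiscreteGeometry.ShellCloseTo (a / 100) T (Finset.image (fun v : EuclideanSpace ℝ (Fin 3) => a • v) Literature.Geometry.DiscreteGeometry.hcpKissingPattern))) :=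
  fun δ _r₀ hδ _ P hP hcore hstat _ hmin => hMS δ hδ P hP hcore hstat hmin

/-- Stub 2 IS the hub crux `PalmUnimodularRigidity.LayeredLawsSelectHcp` (item 9226), verbatim. -/
example : (∀ δ : ℝ, 0 < δ → ∀ P : MeasureTheory.Measure (MeasureTheory.Measure (EuclideanSpace ℝ (Fin 3))), MeasureTheory.IsProbabilityMeasure P → (∀ᵐ μ ∂P, (∃ S : Set (EuclideanSpace ℝ (Fin 3)), (0 : EuclideanSpace ℝ (Fin 3)) ∈ S ∧ (∀ x ∈ S, ∀ y ∈ S, x ≠ y → δ ≤ dist x y) ∧ μ = (MeasureTheory.Measure.count : MeasureTheory.Measure (EuclideanSpace ℝ (Fin 3))).restrict S)) → (∀ g : MeasureTheory.Measure (EuclideanSpace ℝ (Fin 3)) → EuclideanSpace ℝ (Fin 3) → ENNReal, Measurable (Function.uncurry g) → ∫⁻ μ, ∫⁻ y, g μ y ∂μ ∂P = ∫⁻ μ, ∫⁻ y, g (MeasureTheory.Measure.map (fun z => z - y) μ) (-y) ∂μ ∂P) → (∫ μ, (∫ y, Literature.MathematicalPhysics.StatisticalMechanics.lennardJones ‖y‖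 ∂μ) / 2 ∂P) ≤ (⨅ Q : Literature.MathematicalPhysics.StatisticalMechanics.PeriodicConfiguration 3, Q.energyPerParticle Literature.MathematicalPhysics.StatisticalMechanics.lennardJones) → (∀ᵐ μ ∂P, ∃ S : Set (EuclideanSpace ℝ (Fin 3)), μ = (MeasureTheory.Measure.count : MeasureTheory.Measure (EuclideanSpace ℝ (Fin 3))).restrict S ∧ (∀ x ∈ S, (∃ a : ℝ, 9 / 10 ≤ a ∧ a ≤ 1 ∧ ∃ T : Finset (EuclideanSpace ℝ (Fin 3)), (↑T : Set (EuclideanSpace ℝ (Fin 3))) = (fun y : EuclideanSpace ℝ (Fin 3) => y - x) '' {y : EuclideanSpace ℝ (Fin 3) | y ∈ S ∧ y ≠ x ∧ dist y x ≤ 5 / 4 * a} ∧ (Literature.Geometry.DiscreteGeometry.ShellCloseTo (a / 100) T (Finset.image (fun v : EuclideanSpace ℝ (Fin 3) => a • v) Literature.Geometry.DiscreteGeometry.fccKissingPattern) ∨ Literature.Geometry.DiscreteGeometry.ShellCloseTo (a / 100) T (Finset.image (fun v : EuclideanSpace ℝ (Fin 3) => a • v) Literature.Geometry.DiscreteGeometry.hcpKissingPattern))))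 ∧ (∃ s : ℤ → ℤ, Literature.MathematicalPhysics.StatisticalMechanics.IsHaggSeq s ∧ ∃ Φ : EuclideanSpace ℝ (Fin 3) → EuclideanSpace ℝ (Fin 3), Set.BijOn Φ (Literature.MathematicalPhysics.StatisticalMechanics.barlowStacking 1 (Real.sqrt (2 / 3)) s) S ∧ ∀ p ∈ Literature.MathematicalPhysics.StatisticalMechanics.barlowStacking 1 (Real.sqrt (2 / 3)) s, ∀ q ∈ Literature.MathematicalPhysics.StatisticalMechanics.barlowStacking 1 (Real.sqrt (2 / 3)) s, (dist p q = 1 ↔ (0 < dist (Φ p) (Φ q) ∧ dist (Φ p) (Φ q) ≤ 28 / 25)))) → ∀ᵐ μ ∂P, (∃ a h : ℝ, ∃ ha : a ≠ 0, ∃ hh : h ≠ 0, 1 / 2 ≤ a ∧ a ≤ 2 ∧ 1 / 2 ≤ h ∧ h ≤ 2 ∧ ∃ A : EuclideanSpace ℝ (Fin 3) ≃ₗᵢ[ℝ] EuclideanSpace ℝ (Fin 3), (Literature.MathematicalPhysics.StatisticalMechanics.hcpPeriodicConfiguration ha hh).energyPerParticle Literature.MathematicalPhysics.StatisticalMechanics.lennardJones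 = (⨅ Q : Literature.MathematicalPhysics.StatisticalMechanics.PeriodicConfiguration 3, Q.energyPerParticle Literature.MathematicalPhysics.StatisticalMechanics.lennardJones) ∧ μ = (MeasureTheory.Measure.count : MeasureTheory.Measure (EuclideanSpace ℝ (Fin 3))).restrict (A '' Literature.MathematicalPhysics.StatisticalMechanics.hcpStacking a h))) ↔ Summit.AtomisticToContinuum.Crystallization.Theses.PalmUnimodularRigidity.LayeredLawsSelectHcp :=
  Iff.rfl

/-- **`PalmRigidity` (the target of route `PalmUnimodularRigidity`, item 9224) implies this crux
outright** — the route header's remark, now a sorry-free theorem: drop the Delone hypothesis,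
apply `PalmRigidity`, then the charging lemma. -/
theorem DeloneMinimisersChargePeriodic_of_palmRigidity
    (hPalm : Summit.AtomisticToContinuum.Crystallization.Theses.PalmUnimodularRigidity.PalmRigidity) :
    Summit.AtomisticToContinuum.Crystallization.Theses.SurfaceTensionNoFoam.DeloneMinimisersChargePeriodic := by
  intro δ r₀ hδ _hr₀ P hP hcore hstat _hdense hmin
  refine hcpLawsChargeHcp P hP ?_
  filter_upwards [hPalm δ hδ P hP hcore hstat hmin] with μ hμ
  obtain ⟨a, h, ha, hh, h1, h2, h3, h4, A, -, hμA⟩ := hμ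
  exact ⟨a, h, h1, h2, h3, h4, A, hμA⟩

/-- Hence the two HUB CRUXES of route `PalmUnimodularRigidity` (items 9225, 9226) also give this
crux (via the landed glue `cruxesToPalmRigidity_proof` and `ShellsToBarlowChart_of`), sorry-free. -/
theorem DeloneMinimisersChargePeriodic_of_hubCruxes
    (hShells : Summit.AtomisticToContinuum.Crystallization.Theses.PalmUnimodularRigidity.MinimiserShells)
    (hSelect : Summit.AtomisticToContinuum.Crystallization.Theses.PalmUnimodularRigidity.LayeredLawsSelectHcp) :
    Summit.AtomisticToContinuum.Crystallization.Theses.SurfaceTensionNoFoam.DeloneMinimisersChargePeriodic :=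
  DeloneMinimisersChargePeriodic_of_palmRigidity
    (Summit.AtomisticToContinuum.Crystallization.Theorems.PalmUnimodularRigidity.cruxesToPalmRigidity_proof
      hShells
      Summit.AtomisticToContinuum.Crystallization.Cruxes.ShellsToBarlowChart.DevelopTheModelGrowthDescent.ShellsToBarlowChart_of
      hSelect)

end Summit.AtomisticToContinuum.Crystallization.Cruxes.DeloneMinimisersChargePeriodic.Birth
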